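import Summits.CriticalPhenomena.SAWScalingLimit.Theorems.SAWDevelopingMapObservableToSLETypeLadderCarvedReductionConditioning
import Summits.CriticalPhenomena.SAWScalingLimit.Theorems.SAWDevelopingMapObservableToSLETypeLadderCarvedReductionTranslation
import Summits.CriticalPhenomena.SAWScalingLimit.Theorems.SAWDevelopingMapObservableToSLETypeLadderCarvedReductionWeakLimit
import Summits.CriticalPhenomena.SAWScalingLimit.Theorems.SAWDefectDecoherenceObservableToSLERTwoPieceAdmIdentificationLaw
import Literature.Probability.RandomPlanarGeometry.SLELawOneDomainReduction
import HarnessLib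

/-!
# Crux `SAWDevelopingMap.ObservableToSLE` (stmt-CriticalPhenomena-10472), line `six-class-type-ladder`,
stub T2b `stub_carvedReduction` (= twin stub 5a4 of stmt-CriticalPhenomena-14005): pieces (G1c),
(G8), (G9) — the CORE TRANSPORT from a carved cell to the pinned Duminil-Copin–Smirnov law, the
translation covariance of SLE(8/3) laws, and the abstract limit step

Landing target:
`Summits/CriticalPhenomena/SAWScalingLimit/Theorems/SAWDevelopingMapObservableToSLETypeLadderCarvedReductionCore.lean`
(`--supports stmt-CriticalPhenomena-10472`; registered sub-goal `stub_carvedReduction_core`).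

* `core_transport` — on a sub-family cell `Λ''` of the carved law `P = carvedLaw Ω δ S u v` which
  is the lattice translate by `x` of a vertex domain `Λ'` (gate mid-edges `a', b'` translating to
  the gates `s(u,pu)`, `s(v,pv)`): (1) for every bounded continuous `g`,
  `|∫ g∘curve dP − ∫ g(c + δ·triEmbed x) dν(c)| ≤ 2‖g‖ (1 − P(⊆ Λ''))`, `ν` the DCS law of
  `(Λ'; a', b')` at mesh `δ` on curve classes; (2) bad-curve events transfer to the DCS sums of
  `Λ'` through any pair of sets `𝒞 ⊇ (𝒞' translated)` (exact sub-domain conditioning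
  `…CarvedReductionConditioning` + lattice translation covariance `…CarvedReductionTranslation`);
* `isSLELaw_translate` — translates of chordal SLE_κ laws are chordal SLE_κ laws of the
  translated Dobrushin domain (`IsSLELaw.map_conformal` along the similarity `z ↦ z + τ`);
* `exists_close_of_weakLimits` — THE ABSTRACT LIMIT STEP: if the pinned laws `ν_j` are eventually
  probability and tight, the carved integrals `I_j` are `e₁`-close to `∫ f(· + w_j) dν_j`,
  `w_j → w₀`, and EVERY weak subsequential limit `μ` has `|∫ f(· + w₀) dμ − I₀| ≤ e₂`, then some
  `I_j` is within `e₁ + e₂ + e₃` of `I₀` (Prokhorov + Slutsky, `…CarvedReductionWeakLimit`);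
* `stub_carvedReduction_core` — registered one-line packaging of `core_transport` (1).
-/

noncomputable section

open scoped BigOperators Topology NNReal ENNReal Classical BoundedContinuousFunction
open Filter Set MeasureTheory Metric
open Literature.Probability.LatticeModels (HexVertex hexGraph hexCenter triZeta triEmbed Site polyline)
open Literature.Probability.RandomPlanarGeometry
open Literature.Probability.RandomPlanarGeometry.SAW

namespace Summit.CriticalPhenomena.SAWScalingLimit.Theorems.ObservableToSLE.TypeLadder

open Summit.CriticalPhenomena.SAWScalingLimit.Theorems.ObservableToSLER.BridgeGate
open Summit.CriticalPhenomena.SAWScalingLimit.Theorems.ObservableToSLER.TwoPiece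
  (dcsMass_pos integral_dcsLaw dcsLaw_apply isProbabilityMeasure_dcsLaw)

/-! ### Translation covariance of chordal SLE_κ laws -/

/-- The translation homeomorphism is the similarity `z ↦ 1·z + τ`. -/
theorem addRight_eq_similarity (τ : ℂ) : Homeomorph.addRight τ = similarity 1 one_ne_zero τ :=
  Homeomorph.ext fun z => by rw [similarity_apply, one_mul]; rfl

/-- **Translates of chordal SLE_κ laws are chordal SLE_κ laws of the translated domain.**
[cite: Lawler2005, §6.1 p. 149] -/
theorem isSLELaw_translate (τ : ℂ) {κ : ℝ≥0} {M : DobrushinDomain} {μ : Measure (CurveClass ℂ)}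
    (hμ : IsSLELaw κ M μ) :
    IsSLELaw κ (M.map (Homeomorph.addRight τ))
      (μ.map (CurveClass.map ⟨Homeomorph.addRight τ, (Homeomorph.addRight τ).continuous⟩)) := by
  rw [addRight_eq_similarity]
  have h0 := ChordalFamily.hasBoundaryValue_similarityConformalEquiv 1 one_ne_zero τ M.carrier (M.pt 0)
  have h1 := ChordalFamily.hasBoundaryValue_similarityConformalEquiv 1 one_ne_zero τ M.carrier (M.pt 1)
  exact hμ.map_conformal (D := M.map (similarity 1 one_ne_zero τ))
    (ChordalFamily.similarityConformalEquiv 1 one_ne_zero τ M.carrier) h0 h1 (fun z _ => rfl)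

/-! ### The abstract limit step -/

/-- **The abstract limit step (Prokhorov + Slutsky).**  Pinned laws `ν_j`, eventually probability
and eventually uniformly tight; carved integrals `I_j` eventually `e₁`-close to
`∫ f(· + w_j) dν_j` with `w_j → w₀`; every weak subsequential limit `μ` (a probability measure)
has `|∫ f(· + w₀) dμ − I₀| ≤ e₂`.  Then for every `e₃ > 0` some `I_j`, `j ≥ j₀`, is within
`e₁ + e₂ + e₃` of `I₀`. [cite: BillingsleyCPM1999, Thm. 5.1 and Thm. 3.1] -/
theorem exists_close_of_weakLimits (ν : ℕ → Measure (CurveClass ℂ)) (I : ℕ → ℝ) (I₀ : ℝ)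
    (w : ℕ → ℂ) (w₀ : ℂ) (f : CurveClass ℂ →ᵇ ℝ) (e₁ e₂ e₃ : ℝ) (he₃ : 0 < e₃)
    (hP : ∀ᶠ j in atTop, IsProbabilityMeasure (ν j))
    (ht : ∀ η : ℝ, 0 < η → ∃ K : Set (CurveClass ℂ), IsCompact K ∧ ∀ᶠ j in atTop,
      ν j Kᶜ ≤ ENNReal.ofReal η)
    (hI : ∀ᶠ j in atTop, |I j - ∫ c, f (CurveClass.map ⟨Homeomorph.addRight (w j),
      (Homeomorph.addRight (w j)).continuous⟩ c) ∂ν j| ≤ e₁)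
    (hw : Tendsto w atTop (𝓝 w₀))
    (hident : ∀ (χ : ℕ → ℕ) (μ : Measure (CurveClass ℂ)), StrictMono χ → IsProbabilityMeasure μ →
      (∀ g : CurveClass ℂ →ᵇ ℝ, Tendsto (fun i => ∫ c, g c ∂ν (χ i)) atTop (𝓝 (∫ c, g c ∂μ))) →
      |(∫ c, f (CurveClass.map ⟨Homeomorph.addRight w₀, (Homeomorph.addRight w₀).continuous⟩ c) ∂μ) -
        I₀| ≤ e₂)
    (j₀ : ℕ) : ∃ j, j₀ ≤ j ∧ |I j - I₀| ≤ e₁ + e₂ + e₃ := by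
  obtain ⟨χ, μ, hχ, hμ, hconv⟩ := exists_subseq_weakLimit ν hP ht
  haveI := hμ
  have h2 := hident χ μ hχ hμ hconv
  have hχtop : Tendsto χ atTop atTop := hχ.tendsto_atTop
  have hslutsky := tendsto_integral_translate (P := fun i => ν (χ i)) (μ := μ)
    (hχtop.eventually hP) hconv (fun η hη => ?_) (hw.comp hχtop) f
  · have h3 : ∀ᶠ i in atTop, dist (∫ c, f (CurveClass.map ⟨Homeomorph.addRight (w (χ i)),
        (Homeomorph.addRight (w (χ i))).continuous⟩ c) ∂ν (χ i))
        (∫ c, f (CurveClass.map ⟨Homeomorph.addRight w₀, (Homeomorph.addRight w₀).continuous⟩ c) ∂μ) <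
        e₃ := Metric.tendsto_nhds.1 hslutsky e₃ he₃
    have h1 := hχtop.eventually hI
    have hj₀ : ∀ᶠ i in atTop, j₀ ≤ χ i := hχtop.eventually (eventually_ge_atTop j₀)
    obtain ⟨i, hi1, hi3, hij⟩ := (h1.and (h3.and hj₀)).exists
    refine ⟨χ i, hij, ?_⟩
    rw [Real.dist_eq] at hi3
    have := abs_sub_le (I (χ i)) (∫ c, f (CurveClass.map ⟨Homeomorph.addRight (w (χ i)),
        (Homeomorph.addRight (w (χ i))).continuous⟩ c) ∂ν (χ i)) I₀
    have := abs_sub_le (∫ c, f (CurveClass.map ⟨Homeomorph.addRight (w (χ i)),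
        (Homeomorph.addRight (w (χ i))).continuous⟩ c) ∂ν (χ i))
      (∫ c, f (CurveClass.map ⟨Homeomorph.addRight w₀, (Homeomorph.addRight w₀).continuous⟩ c) ∂μ) I₀
    change |_| ≤ e₁ at hi1
    linarith
  · obtain ⟨K, hK, hev⟩ := ht η hη
    exact ⟨K, hK, hχtop.eventually hev⟩

/-! ### The core transport on one carved cell -/

section Core

variable {Ω : Set ℂ} {δ : ℝ} {S : Set HexVertex} {Λ'' Λ' : Finset HexVertex} {u v pu pv : HexVertex}
  {x : Site 2} {a' b' : Sym2 HexVertex}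

variable (hΛ''S : ∀ w ∈ Λ'', w ∉ S)
  (hedge : ∀ w ∈ Λ'', ∀ y ∈ Λ'', hexGraph.Adj w y → (hexDomainGraph Ω δ).Adj w y)
  (hu : u ∈ Λ'') (hpu : pu ∈ S) (hpv : pv ∈ S) (hadj : hexGraph.Adj u pu)
  (hne : s(u, pu) ≠ s(v, pv))
  (hrel : ∀ w : HexVertex, w ∈ Λ'' ↔ ((-x + w.1, w.2) : HexVertex) ∈ Λ')
  (ha : a'.map (fun w : HexVertex => ((x + w.1, w.2) : HexVertex)) = s(u, pu))
  (hb : b'.map (fun w : HexVertex => ((x + w.1, w.2) : HexVertex)) = s(v, pv))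

include hne ha hb in
/-- The pinned gate mid-edges differ, so pinned walks have nonempty vertex lists. -/
theorem verts_ne_nil_of_gates (γ : HexMidEdgeSAW Λ' a' b') : γ.verts ≠ [] := by
  intro h
  have hab : a' = b' := γ.eq_of_nil h
  apply hne
  rw [← ha, ← hb, hab]

include hΛ''S hedge hu hpu hpv hadj hne hrel ha hb

omit hΛ''S hedge hu hpu hpv hadj in
/-- **Transport of DCS sums from the carved sub-family to the pinned domain**: for every `G`,
`Σ_{γ ⊂ Λ'' : s(u,pu) → s(v,pv)} x_c^{ℓ(γ)} G(polyline_δ γ) =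
 Σ_{γ' ⊂ Λ' : a' → b'} x_c^{ℓ(γ')} G(polyline_δ γ' + δ·triEmbed x)`. -/
theorem sum_cell_eq_sum_pinned (G : CurveClass ℂ → ℝ) :
    ∑ γ : HexMidEdgeSAW Λ'' s(u, pu) s(v, pv), hexCriticalFugacity ^ γ.length *
        G (CurveClass.mk ⟨polyline (γ.verts.map fun w => (δ : ℂ) * hexCenter w)⟩) =
      ∑ γ : HexMidEdgeSAW Λ' a' b', hexCriticalFugacity ^ γ.length *
        G (CurveClass.map ⟨Homeomorph.addRight ((δ : ℂ) * triEmbed x),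
          (Homeomorph.addRight ((δ : ℂ) * triEmbed x)).continuous⟩
          (CurveClass.mk ⟨polyline (γ.verts.map fun w => (δ : ℂ) * hexCenter w)⟩)) := by
  have key := sum_hexMidEdgeSAW_translate x hrel a' b'
    (fun l => hexCriticalFugacity ^ l.length *
      G (CurveClass.mk ⟨polyline (l.map fun w => (δ : ℂ) * hexCenter w)⟩))
  rw [ha, hb] at key
  simp only [List.length_map] at key
  rw [show (∑ γ : HexMidEdgeSAW Λ'' s(u, pu) s(v, pv), hexCriticalFugacity ^ γ.length *
        G (CurveClass.mk ⟨polyline (γ.verts.map fun w => (δ : ℂ) * hexCenter w)⟩)) =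
      ∑ γ : HexMidEdgeSAW Λ'' s(u, pu) s(v, pv), hexCriticalFugacity ^ γ.verts.length *
        G (CurveClass.mk ⟨polyline (γ.verts.map fun w => (δ : ℂ) * hexCenter w)⟩) from rfl, key]
  refine Finset.sum_congr rfl fun γ _ => ?_
  rw [mk_polyline_translate x δ (verts_ne_nil_of_gates hne ha hb γ), curveClassMap_add_eq]
  rfl

/-- **THE CORE TRANSPORT, integral form.**  For a probability carved law and bounded continuous
`g`: `|∫ g∘curve dP − ∫ g(c + δ·triEmbed x) dν(c)| ≤ 2‖g‖ (1 − P(⊆ Λ''))`, `ν` the DCS law of the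
pinned domain `(Λ'; a', b')` at mesh `δ`. -/
theorem core_transport [Fintype (HexDomainSAW Ω δ u v)] [IsProbabilityMeasure (carvedLaw Ω δ S u v)]
    (hne' : Nonempty (HexMidEdgeSAW Λ' a' b')) (g : CurveClass ℂ →ᵇ ℝ) :
    |(∫ ξ, g ξ.curve ∂(carvedLaw Ω δ S u v)) -
        ∫ c, g (CurveClass.map ⟨Homeomorph.addRight ((δ : ℂ) * triEmbed x),
          (Homeomorph.addRight ((δ : ℂ) * triEmbed x)).continuous⟩ c)
          ∂(∑ γ : HexMidEdgeSAW Λ' a' b', ENNReal.ofReal (hexCriticalFugacity ^ γ.length /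
            (∑ γ' : HexMidEdgeSAW Λ' a' b', hexCriticalFugacity ^ γ'.length)) •
            Measure.dirac (CurveClass.mk ⟨polyline (γ.verts.map fun w => ((δ : ℝ) : ℂ) *
              hexCenter w)⟩) : Measure (CurveClass ℂ))| ≤
      2 * ‖g‖ * (1 - (carvedLaw Ω δ S u v {ξ | ∀ w ∈ ξ.walk.support, w ∈ Λ''}).toReal) := by
  -- the cell sub-family is nonempty
  have hne'' : Nonempty (HexMidEdgeSAW Λ'' s(u, pu) s(v, pv)) := by
    obtain ⟨e, -⟩ := exists_equiv_hexMidEdgeSAW_translate x hrel a' b'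
    rw [ha, hb] at e
    exact hne'.map e
  have h1 := abs_integral_curve_sub_div_le hΛ''S hedge hu hpu hpv hadj hne g hne''
  -- identify the DCS average of the cell with the pinned integral
  set gτ : CurveClass ℂ →ᵇ ℝ := g.compContinuous
    ⟨CurveClass.map ⟨Homeomorph.addRight ((δ : ℂ) * triEmbed x),
      (Homeomorph.addRight ((δ : ℂ) * triEmbed x)).continuous⟩,
      (lipschitzWith_translate _).continuous⟩ with hgτ
  have hgτapply : ∀ c, gτ c = g (CurveClass.map ⟨Homeomorph.addRight ((δ : ℂ) * triEmbed x),
      (Homeomorph.addRight ((δ : ℂ) * triEmbed x)).continuous⟩ c) := fun c => rfl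
  have h2 := integral_dcsLaw (δ := δ) hne' gτ
  simp only [hgτapply] at h2
  have hnum := sum_cell_eq_sum_pinned (δ := δ) hne hrel ha hb g
  have hden := sum_cell_eq_sum_pinned (δ := δ) hne hrel ha hb (fun _ => 1)
  simp only [mul_one] at hden
  rw [h2, ← hnum, ← hden]
  exact h1

/-- **THE CORE TRANSPORT, event form.**  For sets of curve classes `𝒞` (original frame) and `𝒞'`
(pinned frame) with `c + δ·triEmbed x ∈ 𝒞 → c ∈ 𝒞'`, and `η ≥ 0`: if
`P(curve ∉ 𝒞) ≤ η · P(⊆ Λ'')` then `Σ_{γ' ⊂ Λ' : polyline ∉ 𝒞'} x_c^ℓ ≤ η · Z_{Λ'}`. -/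
theorem core_transport_event [Fintype (HexDomainSAW Ω δ u v)] [IsProbabilityMeasure (carvedLaw Ω δ S u v)]
    (𝒞 𝒞' : Set (CurveClass ℂ))
    (h𝒞 : ∀ c, CurveClass.map ⟨Homeomorph.addRight ((δ : ℂ) * triEmbed x),
      (Homeomorph.addRight ((δ : ℂ) * triEmbed x)).continuous⟩ c ∈ 𝒞 → c ∈ 𝒞')
    {η : ℝ} (hη : 0 ≤ η)
    (h : carvedLaw Ω δ S u v {ξ | ξ.curve ∉ 𝒞} ≤
      ENNReal.ofReal η * carvedLaw Ω δ S u v {ξ | ∀ w ∈ ξ.walk.support, w ∈ Λ''}) :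
    (∑ γ : HexMidEdgeSAW Λ' a' b',
        if CurveClass.mk ⟨polyline (γ.verts.map fun w => (δ : ℂ) * hexCenter w)⟩ ∉ 𝒞'
        then hexCriticalFugacity ^ γ.length else 0) ≤
      η * ∑ γ : HexMidEdgeSAW Λ' a' b', hexCriticalFugacity ^ γ.length := by
  have hx : ∀ n : ℕ, 0 ≤ hexCriticalFugacity ^ n := fun n =>
    pow_nonneg hexCriticalFugacity_pos_lt_one.1.le n
  have h1 := sum_ite_notMem_le_of_carvedLaw_le hΛ''S hedge hu hpu hpv hadj hne 𝒞 hη h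
  -- transport both sums to the pinned domain
  have hbad := sum_cell_eq_sum_pinned (δ := δ) hne hrel ha hb
    (fun c => if c ∉ 𝒞 then 1 else 0)
  have hden := sum_cell_eq_sum_pinned (δ := δ) hne hrel ha hb (fun _ => 1)
  simp only [mul_one] at hden
  simp only [mul_ite, mul_one, mul_zero] at hbad
  rw [hbad, hden] at h1
  refine le_trans (Finset.sum_le_sum fun γ _ => ?_) h1
  by_cases hc : CurveClass.mk ⟨polyline (γ.verts.map fun w => (δ : ℂ) * hexCenter w)⟩ ∈ 𝒞'
  · rw [if_neg (not_not.2 hc)]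
    split_ifs <;> first | exact le_rfl | exact hx _
  · have hc' : CurveClass.map ⟨Homeomorph.addRight ((δ : ℂ) * triEmbed x),
        (Homeomorph.addRight ((δ : ℂ) * triEmbed x)).continuous⟩
        (CurveClass.mk ⟨polyline (γ.verts.map fun w => (δ : ℂ) * hexCenter w)⟩) ∉ 𝒞 :=
      fun h' => hc (h𝒞 _ h')
    rw [if_pos hc, if_pos hc']

end Core

/-- **Registered sub-goal `stub_carvedReduction_core`** (crux item stmt-CriticalPhenomena-10472,
stub T2b `stub_carvedReduction`, piece (G1c) CORE TRANSPORT): on a sub-family cell of a probability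
carved law which is the lattice translate of a pinned vertex domain, the `g∘curve`-integral is
within `2‖g‖(1 − P(⊆ Λ''))` of the translated integral against the pinned DCS law. -/
theorem stub_carvedReduction_core :
    ∀ (Ω : Set ℂ) (δ : ℝ) (S : Set HexVertex) (Λ'' Λ' : Finset HexVertex) (u v pu pv : HexVertex)
      (x : Site 2) (a' b' : Sym2 HexVertex) (g : CurveClass ℂ →ᵇ ℝ),
      Finite (HexDomainSAW Ω δ u v) → IsProbabilityMeasure (carvedLaw Ω δ S u v) →
      (∀ w ∈ Λ'', w ∉ S) → (∀ w ∈ Λ'', ∀ y ∈ Λ'', hexGraph.Adj w y → (hexDomainGraph Ω δ).Adj w y) →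
      u ∈ Λ'' → pu ∈ S → pv ∈ S → hexGraph.Adj u pu → s(u, pu) ≠ s(v, pv) →
      (∀ w : HexVertex, w ∈ Λ'' ↔ ((-x + w.1, w.2) : HexVertex) ∈ Λ') →
      a'.map (fun w : HexVertex => ((x + w.1, w.2) : HexVertex)) = s(u, pu) →
      b'.map (fun w : HexVertex => ((x + w.1, w.2) : HexVertex)) = s(v, pv) →
      Nonempty (HexMidEdgeSAW Λ' a' b') →
      |(∫ ξ, g ξ.curve ∂(carvedLaw Ω δ S u v)) -
          ∫ c, g (CurveClass.map ⟨Homeomorph.addRight ((δ : ℂ) *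
              Literature.Probability.LatticeModels.triEmbed x),
            (Homeomorph.addRight ((δ : ℂ) * Literature.Probability.LatticeModels.triEmbed x)).continuous⟩ c)
            ∂(∑ γ : HexMidEdgeSAW Λ' a' b', ENNReal.ofReal (hexCriticalFugacity ^ γ.length /
              (∑ γ' : HexMidEdgeSAW Λ' a' b', hexCriticalFugacity ^ γ'.length)) •
              Measure.dirac (CurveClass.mk ⟨polyline (γ.verts.map fun w => ((δ : ℝ) : ℂ) *
                hexCenter w)⟩) : Measure (CurveClass ℂ))| ≤
        2 * ‖g‖ * (1 - (carvedLaw Ω δ S u v {ξ | ∀ w ∈ ξ.walk.support, w ∈ Λ''}).toReal) := by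
  intro Ω δ S Λ'' Λ' u v pu pv x a' b' g hfin hP hΛ''S hedge hu hpu hpv hadj hne hrel ha hb hne'
  haveI := hfin
  haveI := Fintype.ofFinite (HexDomainSAW Ω δ u v)
  exact core_transport hΛ''S hedge hu hpu hpv hadj hne hrel ha hb hne' g

end Summit.CriticalPhenomena.SAWScalingLimit.Theorems.ObservableToSLE.TypeLadder

end
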